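import Summits.HodgeConjecture.CorCM.CommonQuarticCMSubfieldCommonPlace
import Summits.HodgeConjecture.CorCM.CommonQuarticCMSubfieldReflexCoincidences
import Summits.HodgeConjecture.CorCM.QuarticCMTypeReflection
import HarnessLib

/-!
# The `(4,4)` cell over a common quartic CM subfield, COMPLETE: additivity ⟺ no common unsplit place

COR-CM (cell `pub-hodgecm2`, binder seat `b16` gen 50, count-neutral claim CM44-COMMONQUARTIC, file F4c; theorems only,
no definition, no named fact, no `sorry`).  NEW as stated, hence under `Summits/`.  HONEST FRAMING: exceptional-class /
Hodge-conjecture statements for NAMED classes of CM abelian varieties, unconditional in the kernel; `HC_CM` is neither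
used nor asserted.

SETTING.  Two slots `I = {i₀, i₁}` with octic CM fields `K_{i₀}`, `K_{i₁}` receiving a quartic CM field `k` (`e₀`, `e₁`).
COMMON PLACE := there are a quartic totally complex subfield `F ≤ K_{i₀}`, an embedding `e″ : F → K_{i₁}` and a place
`u : F → ℂ` which is UNSPLIT (both extensions on the same side) for `Φ_{i₀}` along the inclusion and for `Φ_{i₁}` along
`e″`.  It covers: the same unsplit pair over `k`; `k` Galois (twist by `Aut k`); and the reflex coincidence
`u₀(k₀′) = u₁(k₁′)` of the second quartic CM subfields (in coordinates `N(Δ)·d̄₀·d₁ ∈ (k⁺ˣ)²`).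

* §1 `false_of_apply_eq_mul`, `false_of_apply_eq_apply` — the two IMPOSSIBLE coincidences of F2's four ratios
  (`α₀/β₁`, `β₀/α₁ ∈ F_ℝ` would make an anti-element `τ`-fixed).
* §2 `isNondegenerateFamily_of_apply_ne_mul` — the EXPLICIT additive half: different unsplit pairs and the two ratios
  `z₁(a)/w₁(a)`, `x₂(b₀)/y(b₁)` outside `F_ℝ = z(k⁺)` ⟹ nondegenerate;
  **`isNondegenerateFamily_iff_of_common_quartic`** — THE CRITERION (types): the pair is nondegenerate ⟺ both
  members are nondegenerate ∧ ¬ COMMON PLACE.  (⟹: `CorCM/CommonQuarticCMSubfieldFourfolds` + F4a's «other places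
  split»; ⟸: F4a's one-unsplit-pair data, F3b's fields of definition `F_ℝ(z₁(a), x₂(b₀))`, `F_ℝ(w₁(a), y(b₁))`, F2's
  four-ratio additivity with F1's lattice engine, and F4b's witnesses for the two possible coincidences.)
* §3 ON VARIETIES (two SIMPLE, NON-ISOGENOUS CM fourfolds over a common quartic CM field):
  **`exists_exceptional_prod_iff_fourfolds_of_common_quartic`** — an exceptional Hodge class on some `F₀^a × F₁^b` ⟺
  `Φ_{i₀}` degenerate ∨ `Φ_{i₁}` degenerate ∨ COMMON PLACE; `forall_prod_hodgeClassSpan_eq_iff_fourfolds_of_common_quartic`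
  (`B• = D•` on all products ⟺ …); **`hodgeConjectureFor_prod_fourfolds_of_common_quartic`** — both nondegenerate and no
  common place ⟹ HC + `B• = D•` on every `F₀^a × F₁^b`, UNCONDITIONALLY.

## References

* [Gordon1999HodgeAVSurvey] B. B. Gordon, *A survey of the Hodge conjecture for abelian varieties*, §3 Theorem, 7.4–7.7,
  9.4.3, 10.10.
* [Shimura1998] G. Shimura, *Abelian Varieties with Complex Multiplication and Modular Functions*, §8.3, §8.4 (2)(C),
  §18.1.
* [MoonenZarhin1999LowDim] B. Moonen, Yu. Zarhin, *Hodge classes on abelian varieties of low dimension*, Math. Ann.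
  315 (1999), "Hodge groups of simple abelian fourfolds".
-/

set_option autoImplicit false

noncomputable section

open scoped ComplexConjugate
open CategoryTheory CategoryTheory.Limits NumberField NumberField.ComplexEmbedding Module

namespace Summit.HodgeConjecture.CorCM

open Literature.NumberTheory.ComplexMultiplication
open Literature.AlgebraicGeometry.Motives (AbelianVariety CMType)
open Literature.AlgebraicGeometry.HodgeTheory
open Literature.AlgebraicGeometry.ComplexMultiplication (IsCMTypeRealisation)
open Literature.AlgebraicGeometry.VanGeemen1994 (hodgeClassSpan)
open Literature.AlgebraicGeometry.Pohlmann1968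
open Literature.Barriers.HodgeConjecture (divisorClassesSpan)
open OcticOverQuartic

variable {I : Type} {K : I → Type} [∀ i, Field (K i)] [∀ i, NumberField (K i)] [∀ i, IsCMField (K i)] [Fintype I]
  [DecidableEq I] [Nonempty I] {Φ : ∀ i, CMType (K i)}
variable {k : Type} [Field k] [NumberField k] [IsCMField k]

/-! ### §1 The two impossible coincidences -/

section Impossible

omit [Fintype I] [DecidableEq I] [Nonempty I] [NumberField k] [IsCMField k] [∀ i, IsCMField (K i)] in
/-- `y(e c) = y(e r)·y(b)` with `τb = −b`, `τ ∘ e = e`, `c ≠ 0` is impossible (`e c = e r · b` would be `τ`-anti).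
[folklore] -/
theorem false_of_apply_eq_mul {i : I} (e : k →+* K i) (τ : K i ≃ₐ[ℚ] K i) (hτe : ∀ x : k, τ (e x) = e x) {b : K i}
    (hτb : τ b = -b) (y : K i →+* ℂ) {c r : k} (hc0 : c ≠ 0) (h : y (e c) = y (e r) * y b) : False := by
  rw [← map_mul] at h
  have h1 := y.injective h
  have h2 := congrArg τ h1
  rw [hτe, map_mul, hτe, hτb, h1] at h2
  have h3 : e r * b = 0 := by linear_combination h2 / 2
  rw [← h1, map_eq_zero] at h3
  exact hc0 h3

omit [Fintype I] [DecidableEq I] [Nonempty I] [NumberField k] [IsCMField k] [∀ i, IsCMField (K i)] in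
/-- `x(b) = x(e t)` with `τb = −b`, `b ≠ 0` is impossible. [folklore] -/
theorem false_of_apply_eq_apply {i : I} (e : k →+* K i) (τ : K i ≃ₐ[ℚ] K i) (hτe : ∀ x : k, τ (e x) = e x)
    {b : K i} (hb0 : b ≠ 0) (hτb : τ b = -b) (x : K i →+* ℂ) {t : k} (h : x b = x (e t)) : False := by
  have h1 := x.injective h
  have h2 := congrArg τ h1
  rw [hτb, hτe, ← h1] at h2
  exact hb0 (by linear_combination (-h2) / 2)

end Impossible

/-! ### §2 The criterion for types -/

section Types

/-- **ADDITIVITY BY TWO RATIOS (explicit one-unsplit-pair data).**  `I = {i₀, i₁}`, octic `K_i` over a quartic CM `k`,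
both types nondegenerate, with one-unsplit-pair data `(z₁, z₂, x₂)` for `Φ_{i₀}` and `(w₁, w₂, y)` for `Φ_{i₁}` (fibre of
`z₁` resp. `w₁` inside, `x₂ ∈ Φ_{i₀}` over `z₂` with `x₂τ₀ ∉ Φ_{i₀}`, `y ∈ Φ_{i₁}` over `w₂` with `yτ₁ ∉ Φ_{i₁}`), the
unsplit pairs DIFFERENT (`w₁ ∉ {z₁, z̄₁}`), anti-real generators `a ∈ k`, `b₀ ∈ K_{i₀}`, `b₁ ∈ K_{i₁}`: if neither
`z₁(a)/w₁(a)` nor `x₂(b₀)/y(b₁)` lies in `F_ℝ = z(k⁺)` (in coordinates: `z₁(k) ≠ w₁(k)` and `N(Δ)·d̄₀·d₁ ∉ (k⁺ˣ)²`), the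
pair is NONDEGENERATE.  The other two ratios of F2 are never in `F_ℝ` (§1). [cite: Gordon1999HodgeAVSurvey, §3 Theorem
and 7.5–7.7] [cite: Shimura1998, §8.3 and §8.4 (2)(C)] -/
theorem isNondegenerateFamily_of_apply_ne_mul {i₀ i₁ : I} (h01 : i₀ ≠ i₁) (hI : ∀ j, j = i₀ ∨ j = i₁)
    (hk : finrank ℚ k = 4) (e₀ : k →+* K i₀) (e₁ : k →+* K i₁) (h8₀ : finrank ℚ (K i₀) = 8)
    (h8₁ : finrank ℚ (K i₁) = 8) (hnd : ∀ i, IsNondegenerate (Φ i)) (τ₀ : K i₀ ≃ₐ[ℚ] K i₀) (hτ1₀ : τ₀ ≠ 1)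
    (hτe₀ : ∀ x : k, τ₀ (e₀ x) = e₀ x) (τ₁ : K i₁ ≃ₐ[ℚ] K i₁) (hτ1₁ : τ₁ ≠ 1) (hτe₁ : ∀ x : k, τ₁ (e₁ x) = e₁ x)
    {a : k} (ha0 : a ≠ 0) (ha : IsCMField.complexConj k a = -a) {b₀ : K i₀} (hb0₀ : b₀ ≠ 0)
    (hρb₀ : IsCMField.complexConj (K i₀) b₀ = -b₀) (hτb₀ : τ₀ b₀ = -b₀) {b₁ : K i₁} (hb0₁ : b₁ ≠ 0)
    (hρb₁ : IsCMField.complexConj (K i₁) b₁ = -b₁) (hτb₁ : τ₁ b₁ = -b₁) {z₁ z₂ : k →+* ℂ} {x₂ : K i₀ →+* ℂ}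
    (hz₁ : ∀ v : K i₀ →+* ℂ, v.comp e₀ = z₁ → v ∈ (Φ i₀).1) (hz₂ : z₂ ≠ z₁)
    (hz₂' : z₂ ≠ (starRingAut : ℂ ≃+* ℂ) • z₁) (hx₂e : x₂.comp e₀ = z₂) (hx₂Φ : x₂ ∈ (Φ i₀).1)
    (hx₂τ : x₂.comp τ₀.toRingEquiv.toRingHom ∉ (Φ i₀).1) {w₁ w₂ : k →+* ℂ} {y : K i₁ →+* ℂ}
    (hw₁ : ∀ v : K i₁ →+* ℂ, v.comp e₁ = w₁ → v ∈ (Φ i₁).1) (hw₂ : w₂ ≠ w₁)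
    (hw₂' : w₂ ≠ (starRingAut : ℂ ≃+* ℂ) • w₁) (hye : y.comp e₁ = w₂) (hyΦ : y ∈ (Φ i₁).1)
    (hyτ : y.comp τ₁.toRingEquiv.toRingHom ∉ (Φ i₁).1) (hd : w₁ ≠ z₁) (hd' : w₁ ≠ (starRingAut : ℂ ≃+* ℂ) • z₁)
    (h₁ : ∀ f ∈ IntermediateField.normalClosure ℚ (maximalRealSubfield k) ℂ, z₁ a ≠ f * w₁ a)
    (h₄ : ∀ f ∈ IntermediateField.normalClosure ℚ (maximalRealSubfield k) ℂ, x₂ b₀ ≠ f * y b₁) :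
    CMAlgebra.IsNondegenerateFamily Φ := by
  classical
  have h2₀ : finrank ℚ (K i₀) = 2 * finrank ℚ k := by rw [h8₀, hk]
  have h2₁ : finrank ℚ (K i₁) = 2 * finrank ℚ k := by rw [h8₁, hk]
  set c : ℂ ≃+* ℂ := starRingAut with hc
  -- `w₁ ∈ {z₂, z̄₂}`, `w₂ ∈ {z₁, z̄₁}`
  have hw₁' := eq_or_eq_conj_of_finrank_eq_four hk hz₂ hz₂' w₁ hd hd'
  have hw₂'' : w₂ = z₁ ∨ w₂ = c • z₁ := by
    have h1 : z₁ ≠ w₁ := fun h => hd h.symm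
    have h2 : z₁ ≠ c • w₁ := fun h => hd' (by rw [h, conj_smul_conj_smul])
    exact eq_or_eq_conj_of_finrank_eq_four hk h1 h2 w₂ hw₂ hw₂'
  -- the data of F2
  have hF : ∀ t ∈ IntermediateField.normalClosure ℚ (maximalRealSubfield k) ℂ, conj t = t :=
    fun t ht => conj_apply_of_mem_normalClosure hk ht
  have hz₂x : ∀ r : k, x₂ (e₀ r) = z₂ r := fun r => by rw [← hx₂e]; rfl
  have hw₂y : ∀ r : k, y (e₁ r) = w₂ r := fun r => by rw [← hye]; rfl
  have hαconj : ∀ z : k →+* ℂ, conj (z a) = -z a := fun z => by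
    rw [← IsCMField.complexEmbedding_complexConj k z a, ha, map_neg]
  have hA : ∀ z : k →+* ℂ, z a * z a ∈ IntermediateField.normalClosure ℚ (maximalRealSubfield k) ℂ := fun z => by
    rw [← map_mul]; exact apply_mem_normalClosure z (by rw [map_mul, ha]; ring)
  obtain ⟨r₀, hr₀, hr₀e⟩ := exists_real_apply_eq_mul_self e₀ h2₀ τ₀ hτ1₀ hτe₀ hρb₀ hτb₀
  obtain ⟨r₁, hr₁, hr₁e⟩ := exists_real_apply_eq_mul_self e₁ h2₁ τ₁ hτ1₁ hτe₁ hρb₁ hτb₁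
  have hB₀ : x₂ b₀ * x₂ b₀ ∈ IntermediateField.normalClosure ℚ (maximalRealSubfield k) ℂ := by
    rw [← map_mul, ← hr₀e, hz₂x]; exact apply_mem_normalClosure z₂ hr₀
  have hB₁ : y b₁ * y b₁ ∈ IntermediateField.normalClosure ℚ (maximalRealSubfield k) ℂ := by
    rw [← map_mul, ← hr₁e, hw₂y]; exact apply_mem_normalClosure w₂ hr₁
  refine (isNondegenerateFamily_iff_forall_of_ratios h01 hI
    (F := IntermediateField.normalClosure ℚ (maximalRealSubfield k) ℂ) hF (hαconj z₁)
    (by rw [← IsCMField.complexEmbedding_complexConj (K i₀) x₂ b₀, hρb₀, map_neg]) (hA z₁) hB₀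
    (mul_notMem_of_isNondegenerate hk e₀ h2₀ τ₀ hτ1₀ hτe₀ ha0 ha hb0₀ hρb₀ hτb₀ (Φ i₀) (hnd i₀) hz₁ hz₂ hz₂' hx₂e
      hx₂Φ hx₂τ)
    (hαconj w₁) (by rw [← IsCMField.complexEmbedding_complexConj (K i₁) y b₁, hρb₁, map_neg]) (hA w₁) hB₁
    (mul_notMem_of_isNondegenerate hk e₁ h2₁ τ₁ hτ1₁ hτe₁ ha0 ha hb0₁ hρb₁ hτb₁ (Φ i₁) (hnd i₁) hw₁ hw₂ hw₂' hye
      hyΦ hyτ)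
    (fun σ hσF hσα hσβ => forall_smul_mem_iff_of_fix hk e₀ h2₀ τ₀ hτ1₀ hτe₀ ha0 ha hb0₀ hρb₀ hτb₀ (Φ i₀) hz₁ hz₂
      hz₂' hx₂e hx₂Φ hx₂τ hσF hσα hσβ)
    (fun σ hσF hσα hσβ => forall_smul_mem_iff_of_fix hk e₁ h2₁ τ₁ hτ1₁ hτe₁ ha0 ha hb0₁ hρb₁ hτb₁ (Φ i₁) hw₁ hw₂
      hw₂' hye hyΦ hyτ hσF hσα hσβ)
    h₁ ?_ ?_ h₄).2 hnd
  · -- `α₀ = f β₁`: impossible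
    intro f hf heq
    obtain ⟨r, -, hr⟩ := exists_apply_eq_of_mem_normalClosure hk w₂ hf
    rcases hw₂'' with h | h
    · refine false_of_apply_eq_mul e₁ τ₁ hτe₁ hτb₁ y ha0 (r := r) ?_
      rw [hw₂y, hw₂y, hr, h]; exact heq
    · refine false_of_apply_eq_mul e₁ τ₁ hτe₁ hτb₁ y (neg_ne_zero.2 ha0) (r := r) ?_
      rw [hw₂y, hw₂y, hr, map_neg, h, ringEquiv_smul_apply, ← heq]
      change -conj (z₁ a) = z₁ a
      rw [hαconj, neg_neg]
  · -- `β₀ = f α₁`: impossible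
    intro f hf heq
    obtain ⟨r, -, hr⟩ := exists_apply_eq_of_mem_normalClosure hk z₂ hf
    rcases hw₁' with h | h
    · refine false_of_apply_eq_apply e₀ τ₀ hτe₀ hb0₀ hτb₀ x₂ (t := r * a) ?_
      rw [hz₂x, map_mul, heq, ← hr, h]
    · refine false_of_apply_eq_apply e₀ τ₀ hτe₀ hb0₀ hτb₀ x₂ (t := -(r * a)) ?_
      rw [hz₂x, map_neg, map_mul, heq, ← hr, h, ringEquiv_smul_apply]
      change z₂ r * conj (z₂ a) = -(z₂ r * z₂ a)
      rw [hαconj]; ring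

/-- **THE `(4,4)` CRITERION OVER A COMMON QUARTIC CM SUBFIELD (types).**  `I = {i₀, i₁}`, `[K_i:ℚ] = 8`, `k` quartic CM
received by both.  The family is nondegenerate ⟺ both types are nondegenerate and there is NO COMMON UNSPLIT PLACE over
any quartic totally complex subfield `F ≤ K_{i₀}` embedded into `K_{i₁}`. [cite: Gordon1999HodgeAVSurvey, §3 Theorem,
7.5–7.7 and 9.4.3] [cite: Shimura1998, §8.3 and §8.4 (2)(C)] -/
theorem isNondegenerateFamily_iff_of_common_quartic {i₀ i₁ : I} (h01 : i₀ ≠ i₁) (hI : ∀ j, j = i₀ ∨ j = i₁)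
    (hk : finrank ℚ k = 4) (e₀ : k →+* K i₀) (e₁ : k →+* K i₁) (h8₀ : finrank ℚ (K i₀) = 8)
    (h8₁ : finrank ℚ (K i₁) = 8) :
    CMAlgebra.IsNondegenerateFamily Φ ↔ (∀ i, IsNondegenerate (Φ i)) ∧
      ¬ ∃ (F : IntermediateField ℚ (K i₀)) (e'' : F →+* K i₁) (u : F →+* ℂ), finrank ℚ F = 4 ∧
        IsTotallyComplex F ∧
        (∀ y y' : K i₀ →+* ℂ, y.comp (algebraMap F (K i₀)) = u → y'.comp (algebraMap F (K i₀)) = u →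
          (y ∈ (Φ i₀).1 ↔ y' ∈ (Φ i₀).1)) ∧
        (∀ y y' : K i₁ →+* ℂ, y.comp e'' = u → y'.comp e'' = u → (y ∈ (Φ i₁).1 ↔ y' ∈ (Φ i₁).1)) := by
  classical
  have h2₀ : finrank ℚ (K i₀) = 2 * finrank ℚ k := by rw [h8₀, hk]
  have h2₁ : finrank ℚ (K i₁) = 2 * finrank ℚ k := by rw [h8₁, hk]
  set c : ℂ ≃+* ℂ := starRingAut with hc
  constructor
  · intro hΦ
    refine ⟨hΦ.isNondegenerate, ?_⟩
    rintro ⟨F, e'', u, hF4, htc, hu₀, hu₁⟩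
    haveI := htc
    have h2₀' : finrank ℚ (K i₀) = 2 * finrank ℚ F := by rw [h8₀, hF4]
    have h2₁' : finrank ℚ (K i₁) = 2 * finrank ℚ F := by rw [h8₁, hF4]
    exact not_isNondegenerateFamily_of_common_unsplit_place h01 (algebraMap F (K i₀)) e'' h2₀' h2₁' Φ hu₀ hu₁
      (fun z hz hz' => not_unsplit_of_isNondegenerate_of_unsplit hF4 _ h2₀' (Φ i₀) (hΦ.isNondegenerate i₀) hu₀ z hz hz')
      (fun z hz hz' => not_unsplit_of_isNondegenerate_of_unsplit hF4 _ h2₁' (Φ i₁) (hΦ.isNondegenerate i₁) hu₁ z hz hz')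
      hΦ
  · rintro ⟨hnd, hno⟩
    have hCM₁ := isCMTypeWith_conj (Φ i₁)
    -- structure
    obtain ⟨τ₀, hτ1₀, hτe₀⟩ := exists_algEquiv_over e₀ h2₀
    obtain ⟨τ₁, hτ1₁, hτe₁⟩ := exists_algEquiv_over e₁ h2₁
    obtain ⟨a, ha0, ha⟩ := exists_antireal (k := k)
    obtain ⟨b₀, hb0₀, hρb₀, hτb₀⟩ := exists_antireal_anti e₀ h2₀ τ₀ hτ1₀ hτe₀
    obtain ⟨b₁, hb0₁, hρb₁, hτb₁⟩ := exists_antireal_anti e₁ h2₁ τ₁ hτ1₁ hτe₁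
    obtain ⟨z₁, z₂, x₂, hz₁, hz₂, hz₂', hx₂e, hx₂Φ, hx₂τ⟩ :=
      exists_unsplit_split_of_isNondegenerate hk e₀ h2₀ τ₀ hτ1₀ hτe₀ (Φ i₀) (hnd i₀)
    obtain ⟨w₁, w₂, y, hw₁, hw₂, hw₂', hye, hyΦ, hyτ⟩ :=
      exists_unsplit_split_of_isNondegenerate hk e₁ h2₁ τ₁ hτ1₁ hτe₁ (Φ i₁) (hnd i₁)
    have hu₀ : ∀ v v' : K i₀ →+* ℂ, v.comp e₀ = z₁ → v'.comp e₀ = z₁ → (v ∈ (Φ i₀).1 ↔ v' ∈ (Φ i₀).1) :=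
      fun v v' hv hv' => ⟨fun _ => hz₁ v' hv', fun _ => hz₁ v hv⟩
    -- same pair over `k`: COMMON PLACE by the trivial twist
    by_cases hsame : w₁ = z₁ ∨ w₁ = c • z₁
    · exfalso
      refine hno (exists_commonPlace_of_twist hk e₀ h8₀ τ₀ hτ1₀ hτe₀ hu₀ e₁ fun v v' hv hv' => ?_)
      rcases hsame with h | h
      · exact ⟨fun _ => hw₁ v' (hv'.trans h.symm), fun _ => hw₁ v (hv.trans h.symm)⟩
      · have hout : ∀ t : K i₁ →+* ℂ, t.comp e₁ = z₁ → t ∉ (Φ i₁).1 := fun t ht htΦ =>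
          (hCM₁.rho_smul_mem_iff t).1 (hw₁ _ (by rw [smul_comp_ringHom, ht, h])) htΦ
        exact ⟨fun hv1 => absurd hv1 (hout v hv), fun hv1 => absurd hv1 (hout v' hv')⟩
    rw [not_or] at hsame
    refine isNondegenerateFamily_of_apply_ne_mul h01 hI hk e₀ e₁ h8₀ h8₁ hnd τ₀ hτ1₀ hτe₀ τ₁ hτ1₁ hτe₁ ha0 ha hb0₀
      hρb₀ hτb₀ hb0₁ hρb₁ hτb₁ hz₁ hz₂ hz₂' hx₂e hx₂Φ hx₂τ hw₁ hw₂ hw₂' hye hyΦ hyτ hsame.1 hsame.2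
      (fun f hf heq => ?_) fun f hf heq => ?_
    · -- `z₁(a) = f · w₁(a)`: `z₁(k) = w₁(k)`, a twist of `e₁` carries the unsplit pair of `Φ_{i₁}` onto `z₁`
      obtain ⟨r, -, hr⟩ := exists_apply_eq_of_mem_normalClosure hk w₁ hf
      have hrange : ∀ x : k, z₁ x ∈ Set.range w₁ := by
        intro x
        obtain ⟨p, q, hp, hq, rfl⟩ := exists_real_add_real_mul ha0 ha x
        obtain ⟨p', -, hp'⟩ := exists_apply_eq_of_mem_normalClosure hk w₁ (apply_mem_normalClosure z₁ hp)
        obtain ⟨q', -, hq'⟩ := exists_apply_eq_of_mem_normalClosure hk w₁ (apply_mem_normalClosure z₁ hq)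
        refine ⟨p' + q' * (r * a), ?_⟩
        rw [map_add, map_mul, map_mul, hp', hq', hr, ← heq, map_add, map_mul]
      obtain ⟨g, hg⟩ := QuarticCM.exists_algEquiv_comp_eq_of_forall_mem_range hrange
      refine hno (exists_commonPlace_of_twist hk e₀ h8₀ τ₀ hτ1₀ hτe₀ hu₀ (e₁.comp g.toRingEquiv.toRingHom)
        fun v v' hv hv' => ?_)
      have key : ∀ t : K i₁ →+* ℂ, t.comp (e₁.comp g.toRingEquiv.toRingHom) = z₁ → t.comp e₁ = w₁ := by
        intro t ht
        refine RingHom.ext fun x => ?_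
        have h1 := RingHom.congr_fun ht (g.symm x)
        simp only [RingHom.comp_apply] at h1
        rw [hg] at h1
        simp only [RingHom.comp_apply] at h1
        have h2 : g.toRingEquiv.toRingHom (g.symm x) = x := g.apply_symm_apply x
        rw [h2] at h1
        exact h1
      exact ⟨fun _ => hw₁ v' (key v' hv'), fun _ => hw₁ v (key v hv)⟩
    · -- `x₂(b₀) = f · y(b₁)`: the second subfields coincide, COMMON PLACE
      exact hno (exists_commonPlace_of_ratio_mem hk ha0 ha e₀ h8₀ τ₀ hτ1₀ hτe₀ hb0₀ hρb₀ hτb₀ hx₂Φ hx₂τ e₁ h8₁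
        τ₁ hτ1₁ hτe₁ hρb₁ hτb₁ hyΦ hyτ hf heq)

end Types

/-! ### §3 Simple CM fourfolds over a common quartic CM field -/

section Varieties

variable {A : I → AbelianVariety ℂ} {ι : ∀ i, 𝓞 (K i) →+* End (A i)}
  {θ : ∀ i, K i →+* Module.End ℂ (complexBetti (A i).X 1)}

/-- **THE `(4,4)` CELL OVER A COMMON QUARTIC CM FIELD, ON VARIETIES.**  Two SIMPLE, NON-ISOGENOUS CM abelian fourfolds
whose octic CM fields receive a common quartic CM field `k`: there is an exceptional Hodge class (rational `(m,m)`-class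
outside `Dᵐ ⊗ ℂ`) on some `A_{i₀}^a × A_{i₁}^b` ⟺ `Φ_{i₀}` is degenerate ∨ `Φ_{i₁}` is degenerate ∨ COMMON PLACE.
[cite: Gordon1999HodgeAVSurvey, 7.4–7.7 and 9.4.3] [cite: MoonenZarhin1999LowDim, "Hodge groups of simple abelian fourfolds"] -/
theorem exists_exceptional_prod_iff_fourfolds_of_common_quartic {i₀ i₁ : I} (h01 : i₀ ≠ i₁)
    (hI : ∀ j, j = i₀ ∨ j = i₁) (hk : finrank ℚ k = 4) (e₀ : k →+* K i₀) (e₁ : k →+* K i₁) (hd₀ : (A i₀).dim = 4)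
    (hd₁ : (A i₁).dim = 4) (hA : ∀ i, IsCMTypeRealisation (Φ i) (A i) (ι i) (θ i)) (hs : ∀ i, (A i).IsSimple)
    (hniso : ∀ i j, i ≠ j → ¬ AbelianVariety.IsIsogenous (A i) (A j)) :
    (∃ (N : ℕ) (π : Fin N → I) (m : ℕ) (c : complexBetti (⨁ fun j : Fin N => A (π j)).X (2 * m)),
        IsRationalClass c ∧
        IsOfHodgeType (⨁ fun j : Fin N => A (π j)).dim (⨁ fun j : Fin N => A (π j)).X (2 * m) m m c ∧
        c ∉ divisorClassesSpan (⨁ fun j : Fin N => A (π j)).X (⨁ fun j : Fin N => A (π j)).dim m) ↔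
      ¬ IsNondegenerate (Φ i₀) ∨ ¬ IsNondegenerate (Φ i₁) ∨
      ∃ (F : IntermediateField ℚ (K i₀)) (e'' : F →+* K i₁) (u : F →+* ℂ), finrank ℚ F = 4 ∧
        IsTotallyComplex F ∧
        (∀ y y' : K i₀ →+* ℂ, y.comp (algebraMap F (K i₀)) = u → y'.comp (algebraMap F (K i₀)) = u →
          (y ∈ (Φ i₀).1 ↔ y' ∈ (Φ i₀).1)) ∧
        (∀ y y' : K i₁ →+* ℂ, y.comp e'' = u → y'.comp e'' = u → (y ∈ (Φ i₁).1 ↔ y' ∈ (Φ i₁).1)) := by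
  have h8₀ : finrank ℚ (K i₀) = 8 := by rw [finrank_eq_two_mul_dim_of_isCMTypeRealisation (hA i₀), hd₀]
  have h8₁ : finrank ℚ (K i₁) = 8 := by rw [finrank_eq_two_mul_dim_of_isCMTypeRealisation (hA i₁), hd₁]
  have hsep := CMAlgebra.isSeparatingFamily_of_isSimple_of_pairwise_not_isIsogenous hA hs hniso
  have key := isNondegenerateFamily_iff_of_common_quartic (Φ := Φ) h01 hI hk e₀ e₁ h8₀ h8₁
  constructor
  · rintro ⟨N, π, m, c, hc, hpq, hnot⟩
    by_contra hcon
    simp only [not_or, not_not] at hcon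
    obtain ⟨h1, h2, h3⟩ := hcon
    have hnd : ∀ i, IsNondegenerate (Φ i) := fun i => by
      rcases hI i with rfl | rfl
      · exact h1
      · exact h2
    exact (key.2 ⟨hnd, h3⟩).not_exists_exceptional_prod hA π m ⟨c, hc, hpq, hnot⟩
  · intro hor
    refine CMAlgebra.exists_exceptional_prod_of_not_isNondegenerateFamily hsep (fun hΦ => ?_) hA
    obtain ⟨h1, h2⟩ := key.1 hΦ
    rcases hor with h | h | h
    · exact h (h1 i₀)
    · exact h (h1 i₁)
    · exact h2 h

/-- **`B• = D•` on every `A_{i₀}^a × A_{i₁}^b`** ⟺ both types nondegenerate ∧ no common place (same hypotheses).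
[cite: Gordon1999HodgeAVSurvey, 7.5 and 7.6.1] -/
theorem forall_prod_hodgeClassSpan_eq_iff_fourfolds_of_common_quartic {i₀ i₁ : I} (h01 : i₀ ≠ i₁)
    (hI : ∀ j, j = i₀ ∨ j = i₁) (hk : finrank ℚ k = 4) (e₀ : k →+* K i₀) (e₁ : k →+* K i₁) (hd₀ : (A i₀).dim = 4)
    (hd₁ : (A i₁).dim = 4) (hA : ∀ i, IsCMTypeRealisation (Φ i) (A i) (ι i) (θ i)) (hs : ∀ i, (A i).IsSimple)
    (hniso : ∀ i j, i ≠ j → ¬ AbelianVariety.IsIsogenous (A i) (A j)) :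
    (∀ (N : ℕ) (π : Fin N → I) (m : ℕ),
        hodgeClassSpan (⨁ fun j : Fin N => A (π j)).dim (⨁ fun j : Fin N => A (π j)).X m =
          divisorClassesSpan (⨁ fun j : Fin N => A (π j)).X (⨁ fun j : Fin N => A (π j)).dim m) ↔
      (∀ i, IsNondegenerate (Φ i)) ∧
      ¬ ∃ (F : IntermediateField ℚ (K i₀)) (e'' : F →+* K i₁) (u : F →+* ℂ), finrank ℚ F = 4 ∧
        IsTotallyComplex F ∧
        (∀ y y' : K i₀ →+* ℂ, y.comp (algebraMap F (K i₀)) = u → y'.comp (algebraMap F (K i₀)) = u →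
          (y ∈ (Φ i₀).1 ↔ y' ∈ (Φ i₀).1)) ∧
        (∀ y y' : K i₁ →+* ℂ, y.comp e'' = u → y'.comp e'' = u → (y ∈ (Φ i₁).1 ↔ y' ∈ (Φ i₁).1)) := by
  have h8₀ : finrank ℚ (K i₀) = 8 := by rw [finrank_eq_two_mul_dim_of_isCMTypeRealisation (hA i₀), hd₀]
  have h8₁ : finrank ℚ (K i₁) = 8 := by rw [finrank_eq_two_mul_dim_of_isCMTypeRealisation (hA i₁), hd₁]
  have hsep := CMAlgebra.isSeparatingFamily_of_isSimple_of_pairwise_not_isIsogenous hA hs hniso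
  rw [← CMAlgebra.isNondegenerateFamily_iff_forall_prod_hodgeClassSpan_eq hsep hA]
  exact isNondegenerateFamily_iff_of_common_quartic h01 hI hk e₀ e₁ h8₀ h8₁

/-- **The Hodge conjecture on every `A_{i₀}^a × A_{i₁}^b` for two CM fourfold realisations over a common quartic CM field,
both types nondegenerate and with NO common unsplit place** — with `B• = D•` there; UNCONDITIONAL.  (No simplicity or
non-isogeny is needed in this direction.) [cite: Gordon1999HodgeAVSurvey, §3 Theorem and 10.10] -/
theorem hodgeConjectureFor_prod_fourfolds_of_common_quartic {i₀ i₁ : I} (h01 : i₀ ≠ i₁) (hI : ∀ j, j = i₀ ∨ j = i₁)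
    (hk : finrank ℚ k = 4) (e₀ : k →+* K i₀) (e₁ : k →+* K i₁) (hd₀ : (A i₀).dim = 4) (hd₁ : (A i₁).dim = 4)
    (hA : ∀ i, IsCMTypeRealisation (Φ i) (A i) (ι i) (θ i)) (hnd : ∀ i, IsNondegenerate (Φ i))
    (hno : ¬ ∃ (F : IntermediateField ℚ (K i₀)) (e'' : F →+* K i₁) (u : F →+* ℂ), finrank ℚ F = 4 ∧
        IsTotallyComplex F ∧
        (∀ y y' : K i₀ →+* ℂ, y.comp (algebraMap F (K i₀)) = u → y'.comp (algebraMap F (K i₀)) = u →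
          (y ∈ (Φ i₀).1 ↔ y' ∈ (Φ i₀).1)) ∧
        (∀ y y' : K i₁ →+* ℂ, y.comp e'' = u → y'.comp e'' = u → (y ∈ (Φ i₁).1 ↔ y' ∈ (Φ i₁).1)))
    {N : ℕ} (π : Fin N → I) :
    HodgeConjectureFor (⨁ fun j : Fin N => A (π j)).dim (⨁ fun j : Fin N => A (π j)).X ∧
      ∀ m : ℕ, hodgeClassSpan (⨁ fun j : Fin N => A (π j)).dim (⨁ fun j : Fin N => A (π j)).X m =
        divisorClassesSpan (⨁ fun j : Fin N => A (π j)).X (⨁ fun j : Fin N => A (π j)).dim m := by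
  have h8₀ : finrank ℚ (K i₀) = 8 := by rw [finrank_eq_two_mul_dim_of_isCMTypeRealisation (hA i₀), hd₀]
  have h8₁ : finrank ℚ (K i₁) = 8 := by rw [finrank_eq_two_mul_dim_of_isCMTypeRealisation (hA i₁), hd₁]
  have h := (isNondegenerateFamily_iff_of_common_quartic h01 hI hk e₀ e₁ h8₀ h8₁).2 ⟨hnd, hno⟩
  exact ⟨h.hodgeConjectureFor_prod hA π, fun m => h.hodgeClassSpan_prod_eq_divisorClassesSpan hA π m⟩

end Varieties

end Summit.HodgeConjecture.CorCM

end
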